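import Literature.Combinatorics.SimpleGraph.GraphDivisors
import Mathlib.Combinatorics.SimpleGraph.LapMatrix
import Mathlib.Combinatorics.SimpleGraph.Connectivity.Connected
import HarnessLib

/-!
# Harmonic morphisms of (simple) graphs: multiplicities, the degree identity, the degree of a
# harmonic morphism, pull-back of harmonic functions and of divisors, and the Riemann–Hurwitz
# formula (Baker–Norine 2009, §2.1–§2.3; Urakawa 2000)

Source (held, read at the page; statements VERBATIM). M. Baker, S. Norine, *Harmonic morphisms
and hyperelliptic graphs*, Int. Math. Res. Not. IMRN 2009, no. 15, 2914–2955 [BakerNorine2009]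
(held text `paper:arxiv-0707.1309`, chunks p0007–p0008). §2.1: «A function
`φ : V(G) ∪ E(G) → V(G′) ∪ E(G′)` is said to be a morphism from `G` to `G′` if `φ(V(G)) ⊆ V(G′)`,
and for every `x ∈ V(G)` and `e ∈ E(G)` such that `x ∈ e`, either `φ(e) ∈ E(G′)` and
`φ(x) ∈ φ(e)`, or `φ(e) = φ(x)`. […] **Definition.** A morphism `φ : G → G′` is said to be harmonic
(or horizontally conformal) if for all `x ∈ V(G), y ∈ V(G′)` such that `y = φ(x)`, the quantity
`|{e ∈ E(G) | x ∈ e, φ(e) = e′}|` is the same for all edges `e′ ∈ E(G′)` such that `y ∈ e′`.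
[…] Define the vertical multiplicity of `φ` at `x` by `v_φ(x) = |{e ∈ E(G) | φ(e) = φ(x)}|` […]
the horizontal multiplicity of `φ` at `x` by `m_φ(x) = |{e ∈ E(G) | x ∈ e, φ(e) = e′}|` for any
edge `e′ ∈ E(G′)` such that `φ(x) ∈ e′` […] When `|V(G′)| = 1`, we define `m_φ(x)` to be `0`
[…] we have the following basic formula relating the horizontal and vertical multiplicities:
(2.1) `deg(x) = deg(φ(x)) m_φ(x) + v_φ(x)`. […] we define the degree of a harmonic morphism
`φ : G → G′` by the formula `deg(φ) := |{e ∈ E(G) | φ(e) = e′}|` for any edge `e′ ∈ E(G′)`. […]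
**Lemma 9.** The quantity `|{e ∈ E(G) | φ(e) = e′}|` is independent of the choice of
`e′ ∈ E(G′)`. […] **Lemma 10.** For any vertex `y ∈ G′`, we have
`deg(φ) = Σ_{x ∈ V(G), φ(x) = y} m_φ(x)`.» §2.2, proof of **Proposition 12** («`φ` is
`A`-harmonic for every abelian group `A`»): «`Σ_{e = zx ∈ E(G)} f(φ(z)) = v_φ(x) f(y) +
Σ_{e′ = z′y ∈ E(G′)} m_φ(x) f(z′)`». §2.3: «we define the push-forward homomorphism
`φ_* : Div(G) → Div(G′)` by `φ_*(D) = Σ_{x ∈ V(G)} D(x) (φ(x))`. Similarly, we define the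
pullback homomorphism `φ^* : Div(G′) → Div(G)` by `φ^*(D′) = Σ_{y ∈ V(G′)} Σ_{x ∈ V(G), φ(x) = y}
m_φ(x) D′(y) (x)`. **Lemma 15.** If `φ : G → G′` is a harmonic morphism and `D′ ∈ Div(G′)`, then
`deg(φ^*(D′)) = deg(φ) · deg(D′)`. […] **Theorem 16 (Riemann–Hurwitz for graphs).** Let `G, G′`
be graphs, and let `φ : G → G′` be a harmonic morphism. Then: (1) The canonical divisors on `G`
and `G′` are related by the formula `K_G = φ^* K_{G′} + R_G`, where
`R_G = 2 Σ_{x ∈ V(G)} (m_φ(x) − 1)(x) + Σ_{x ∈ V(G)} v_φ(x)(x)`. (2) If `G, G′` have genus `g`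
and `g′`, respectively, then `2g − 2 = deg(φ)(2g′ − 2) + Σ_{x ∈ V(G)} (2(m_φ(x) − 1) + v_φ(x))`.»
The graphs of the source are connected multigraphs without loops.

## What is formalised — the case of SIMPLE graphs (Urakawa's original setting, [BakerNorine2009,
## §2.1 first paragraph]); vocabulary: the tree's `canonicalDivisor`, `genus`, `LinEquiv` of
## `GraphDivisors`, `Δ(f) = G.lapMatrix ℤ *ᵥ f`

For simple graphs a morphism is a vertex map `φ` sending each edge `xu` either to the edge
`φ(x)φ(u)` or to the vertex `φ(x) = φ(u)`, and `|{e ∈ E(G) | x ∈ e, φ(e) = φ(x)y′}|` is the number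
of neighbours `u` of `x` with `φ(u) = y′`.
-- TODO(general form): multigraphs (the source's generality) need an edge-labelled graph type.
* definitions `IsHarmonicMorphism G G′ φ`, `vertMult` (`v_φ`), `horizMult` (`m_φ`), `harmonicDegree`
  (`Σ_{φ(x) = y} m_φ(x)`, the degree of `φ` read at `y`, Lemma 10), `divPushforward` (`φ_*`),
  `divPullback` (`φ^*`);
* `IsHarmonicMorphism.horizMult_eq`; the **degree identity (2.1)** `IsHarmonicMorphism.degree_eq`;
* **Lemmas 9–10** `IsHarmonicMorphism.harmonicDegree_eq_of_adj` / `harmonicDegree_eq_of_reachable` /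
  `harmonicDegree_eq` (the degree does not depend on the vertex, `G′` connected);
* **Proposition 12** `IsHarmonicMorphism.sum_neighborFinset_comp` and its Laplacian form
  `lapMatrix_mulVec_comp` (`Δ(f ∘ φ)(x) = m_φ(x) · Δ′(f)(φ(x))`: harmonic functions pull back),
  hence `divPullback_lapMatrix_mulVec` (`φ^* Δ′(f) = Δ(f ∘ φ)`) and `linEquiv_divPullback` (`φ^*`
  preserves linear equivalence, so it induces `Jac(G′) → Jac(G)`);
* **Lemma 15** `IsHarmonicMorphism.sum_divPullback`; **Theorem 16 (1), (2)**
  `canonicalDivisor_eq_divPullback_add` and `two_mul_genus_sub_two_eq` (part (3) needs edge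
  contraction and is not formalised here).

Definitions with bodies and theorems only; no `sorry`; no named facts.
-/

open Finset SimpleGraph Matrix

namespace Literature.Combinatorics.SimpleGraph.BakerNorine

variable {V V' : Type*} [Fintype V] [Fintype V'] [DecidableEq V']
variable (G : SimpleGraph V) [DecidableRel G.Adj] (G' : SimpleGraph V') [DecidableRel G'.Adj]

/-! ### Definitions -/

/-- A **harmonic morphism** of simple graphs `φ : G → G′`: a vertex map sending every edge `xu`
either to an edge `φ(x)φ(u)` of `G′` (a horizontal edge) or to a vertex `φ(x) = φ(u)` (a vertical
edge), which is horizontally conformal: for each `x`, the number of neighbours `u` of `x` mapped to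
`y′` is the same for all neighbours `y′` of `φ(x)`. [cite: BakerNorine2009, §2.1 (Definition)] -/
structure IsHarmonicMorphism (φ : V → V') : Prop where
  /-- every edge is horizontal or vertical -/
  adj_or_eq : ∀ ⦃x u : V⦄, G.Adj x u → G'.Adj (φ x) (φ u) ∨ φ x = φ u
  /-- horizontal conformality -/
  conformal : ∀ (x : V) ⦃y₁ y₂ : V'⦄, G'.Adj (φ x) y₁ → G'.Adj (φ x) y₂ →
    #{u ∈ G.neighborFinset x | φ u = y₁} = #{u ∈ G.neighborFinset x | φ u = y₂}

/-- The **vertical multiplicity** `v_φ(x)`: the number of vertical edges at `x` (neighbours `u`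
with `φ(u) = φ(x)`). [cite: BakerNorine2009, §2.1] -/
def vertMult (φ : V → V') (x : V) : ℕ := #{u ∈ G.neighborFinset x | φ u = φ x}

/-- The **horizontal multiplicity** `m_φ(x)`: the number of neighbours of `x` mapped to `y′`, for
any neighbour `y′` of `φ(x)` (independent of `y′` for a harmonic `φ`, `horizMult_eq`); `0` when
`φ(x)` has no neighbour. [cite: BakerNorine2009, §2.1] -/
noncomputable def horizMult (φ : V → V') (x : V) : ℕ :=
  if h : ∃ y, G'.Adj (φ x) y then #{u ∈ G.neighborFinset x | φ u = Classical.choose h} else 0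

/-- `Σ_{φ(x) = y} m_φ(x)`: the **degree** of `φ` read at the vertex `y` (Lemma 10; independent of
`y` when `G′` is connected, `harmonicDegree_eq`).
[cite: BakerNorine2009, §2.1 (eq. (2.2), Lemma 10)] -/
noncomputable def harmonicDegree (φ : V → V') (y : V') : ℕ :=
  ∑ x ∈ univ.filter (fun x => φ x = y), horizMult G G' φ x

/-- The **push-forward** `φ_*(D)(y) = Σ_{φ(x) = y} D(x)`.
[cite: BakerNorine2009, §2.3 (eq. (2.4))] -/
def divPushforward (φ : V → V') (D : V → ℤ) : V' → ℤ :=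
  fun y => ∑ x ∈ univ.filter (fun x => φ x = y), D x

/-- The **pull-back** `φ^*(D′)(x) = m_φ(x) · D′(φ(x))`. [cite: BakerNorine2009, §2.3 (eq. (2.5))] -/
noncomputable def divPullback (φ : V → V') (D' : V' → ℤ) : V → ℤ :=
  fun x => (horizMult G G' φ x : ℤ) * D' (φ x)

variable {G G'}

omit [Fintype V'] in
/-- `v_φ(x) = |{u ∼ x : φ(u) = φ(x)}|`. [cite: BakerNorine2009, §2.1] -/
theorem vertMult_apply (φ : V → V') (x : V) :
    vertMult G φ x = #{u ∈ G.neighborFinset x | φ u = φ x} := rfl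

/-- `deg(φ)` read at `y`: `Σ_{φ(x) = y} m_φ(x)`. [cite: BakerNorine2009, §2.1 (Lemma 10)] -/
theorem harmonicDegree_apply (φ : V → V') (y : V') :
    harmonicDegree G G' φ y = ∑ x ∈ univ.filter (fun x => φ x = y), horizMult G G' φ x := rfl

omit [Fintype V'] in
/-- `φ_*(D)(y) = Σ_{φ(x) = y} D(x)`. [cite: BakerNorine2009, §2.3 (eq. (2.4))] -/
theorem divPushforward_apply (φ : V → V') (D : V → ℤ) (y : V') :
    divPushforward φ D y = ∑ x ∈ univ.filter (fun x => φ x = y), D x := rfl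

/-- `φ^*(D′)(x) = m_φ(x) D′(φ(x))`. [cite: BakerNorine2009, §2.3 (eq. (2.5))] -/
theorem divPullback_apply (φ : V → V') (D' : V' → ℤ) (x : V) :
    divPullback G G' φ D' x = (horizMult G G' φ x : ℤ) * D' (φ x) := rfl

/-- `m_φ(x) = 0` when `φ(x)` has no neighbour (e.g. `|V(G′)| = 1`). [cite: BakerNorine2009, §2.1] -/
theorem horizMult_eq_zero_of_forall_not_adj {φ : V → V'} {x : V} (h : ∀ y, ¬ G'.Adj (φ x) y) :
    horizMult G G' φ x = 0 := by
  unfold horizMult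
  rw [dif_neg (not_exists.2 h)]

/-- For a harmonic `φ`, `m_φ(x)` is the number of neighbours of `x` over ANY neighbour `y` of
`φ(x)` («`m_φ(x)` is independent of the choice of `e′`»). [cite: BakerNorine2009, §2.1] -/
theorem IsHarmonicMorphism.horizMult_eq {φ : V → V'} (hφ : IsHarmonicMorphism G G' φ) {x : V}
    {y : V'} (hy : G'.Adj (φ x) y) : horizMult G G' φ x = #{u ∈ G.neighborFinset x | φ u = y} := by
  have hex : ∃ y, G'.Adj (φ x) y := ⟨y, hy⟩
  unfold horizMult
  rw [dif_pos hex]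
  exact hφ.conformal x (Classical.choose_spec hex) hy

/-! ### The degree identity (2.1) and Proposition 12 -/

section Local

variable {φ : V → V'} (hφ : IsHarmonicMorphism G G' φ)
include hφ

/-- The neighbours of `x` map into `{φ(x)} ∪ N(φ(x))` (a morphism sends each edge to an edge
or a vertex). [cite: BakerNorine2009, §2.1 (morphism)] -/
private theorem IsHarmonicMorphism.mapsTo (x : V) :
    ∀ u ∈ G.neighborFinset x, φ u ∈ insert (φ x) (G'.neighborFinset (φ x)) := by
  intro u hu
  rw [mem_neighborFinset] at hu
  rcases hφ.adj_or_eq hu with h | h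
  · exact mem_insert_of_mem ((mem_neighborFinset _ _ _).2 h)
  · rw [h]; exact mem_insert_self _ _

/-- **Proposition 12** (the computation in its proof): for any `f : V(G′) → ℤ`,
`Σ_{u ∼ x} f(φ(u)) = v_φ(x) f(φ(x)) + m_φ(x) Σ_{z′ ∼ φ(x)} f(z′)`.
[cite: BakerNorine2009, Proposition 12 (proof)] -/
theorem IsHarmonicMorphism.sum_neighborFinset_comp (f : V' → ℤ) (x : V) :
    ∑ u ∈ G.neighborFinset x, f (φ u) =
      (vertMult G φ x : ℤ) * f (φ x) +
        (horizMult G G' φ x : ℤ) * ∑ z ∈ G'.neighborFinset (φ x), f z := by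
  rw [← Finset.sum_fiberwise_of_maps_to' (hφ.mapsTo x) f,
    Finset.sum_insert (G'.notMem_neighborFinset_self (φ x)), Finset.mul_sum]
  congr 1
  · rw [Finset.sum_const, nsmul_eq_mul, vertMult_apply]
  · refine Finset.sum_congr rfl fun z hz => ?_
    rw [Finset.sum_const, nsmul_eq_mul, hφ.horizMult_eq ((mem_neighborFinset _ _ _).1 hz)]

/-- **The degree identity (2.1)**: `deg(x) = deg(φ(x)) m_φ(x) + v_φ(x)`.
[cite: BakerNorine2009, §2.1 (eq. (2.1))] -/
theorem IsHarmonicMorphism.degree_eq (x : V) :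
    G.degree x = G'.degree (φ x) * horizMult G G' φ x + vertMult G φ x := by
  have h := hφ.sum_neighborFinset_comp (fun _ => (1 : ℤ)) x
  simp only [Finset.sum_const, mul_one, card_neighborFinset_eq_degree] at h
  rw [nsmul_eq_mul, mul_one, nsmul_eq_mul, mul_one] at h
  have h' : (G.degree x : ℤ) = (G'.degree (φ x) * horizMult G G' φ x + vertMult G φ x : ℕ) := by
    push_cast
    linarith
  exact_mod_cast h'

/-! ### Lemmas 9–10: the degree of a harmonic morphism -/

/-- Double counting of the edges of `G` over the edge `yz` of `G′`:
`Σ_{φ(x) = y} m_φ(x) = Σ_{φ(u) = z} m_φ(u)` for adjacent `y, z` — both count the pairs `(x, u)`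
with `x ∼ u`, `φ(x) = y`, `φ(u) = z`. [cite: BakerNorine2009, Lemma 9 (proof, eq. (2.3))] -/
theorem IsHarmonicMorphism.harmonicDegree_eq_of_adj {y z : V'} (hyz : G'.Adj y z) :
    harmonicDegree G G' φ y = harmonicDegree G G' φ z := by
  rw [harmonicDegree_apply, harmonicDegree_apply]
  -- rewrite each multiplicity as a count over the other fibre
  have hy : ∀ x ∈ univ.filter (fun x => φ x = y),
      horizMult G G' φ x = ∑ u ∈ univ.filter (fun u => φ u = z), if G.Adj x u then 1 else 0 := by
    intro x hx
    have hxy : φ x = y := (mem_filter.1 hx).2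
    rw [hφ.horizMult_eq (y := z) (by rw [hxy]; exact hyz), ← Finset.card_filter]
    congr 1
    ext u
    simp only [mem_filter, mem_neighborFinset, mem_univ, true_and]
    exact and_comm
  have hz : ∀ u ∈ univ.filter (fun u => φ u = z),
      horizMult G G' φ u = ∑ x ∈ univ.filter (fun x => φ x = y), if G.Adj x u then 1 else 0 := by
    intro u hu
    have huz : φ u = z := (mem_filter.1 hu).2
    rw [hφ.horizMult_eq (y := y) (by rw [huz]; exact hyz.symm), ← Finset.card_filter]
    congr 1
    ext x
    simp only [mem_filter, mem_neighborFinset, mem_univ, true_and]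
    rw [G.adj_comm]
    exact and_comm
  rw [Finset.sum_congr rfl hy, Finset.sum_congr rfl hz, Finset.sum_comm]

/-- **Lemma 9**: the degree read at `y` is constant along walks of `G′`.
[cite: BakerNorine2009, Lemma 9] -/
theorem IsHarmonicMorphism.harmonicDegree_eq_of_reachable {y z : V'} (h : G'.Reachable y z) :
    harmonicDegree G G' φ y = harmonicDegree G G' φ z := by
  obtain ⟨p⟩ := h
  induction p with
  | nil => rfl
  | cons hadj _ ih => exact (hφ.harmonicDegree_eq_of_adj hadj).trans ih

/-- **Lemmas 9–10**: for connected `G′`, `deg(φ) = Σ_{φ(x) = y} m_φ(x)` does not depend on `y`.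
[cite: BakerNorine2009, Lemma 9, Lemma 10] -/
theorem IsHarmonicMorphism.harmonicDegree_eq (hG' : G'.Connected) (y z : V') :
    harmonicDegree G G' φ y = harmonicDegree G G' φ z :=
  hφ.harmonicDegree_eq_of_reachable (hG'.preconnected y z)

/-! ### Lemma 15 and the Riemann–Hurwitz formula (Theorem 16) -/

/-- **Lemma 15**: `deg(φ^*(D′)) = deg(φ) · deg(D′)` (`G′` connected; the degree read at any
`y₀`). [cite: BakerNorine2009, Lemma 15] -/
theorem IsHarmonicMorphism.sum_divPullback (hG' : G'.Connected) (y₀ : V') (D' : V' → ℤ) :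
    ∑ x, divPullback G G' φ D' x = (harmonicDegree G G' φ y₀ : ℤ) * ∑ y, D' y := by
  have hmaps : ∀ x ∈ (univ : Finset V), φ x ∈ (univ : Finset V') := fun x _ => mem_univ _
  rw [← Finset.sum_fiberwise_of_maps_to hmaps, Finset.mul_sum]
  refine Finset.sum_congr rfl fun y _ => ?_
  have h1 : ∑ x ∈ univ.filter (fun x => φ x = y), divPullback G G' φ D' x =
      ∑ x ∈ univ.filter (fun x => φ x = y), (horizMult G G' φ x : ℤ) * D' y :=
    Finset.sum_congr rfl fun x hx => by rw [divPullback_apply, (mem_filter.1 hx).2]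
  rw [h1, ← Finset.sum_mul, hφ.harmonicDegree_eq hG' y₀ y, harmonicDegree_apply]
  push_cast
  ring

/-- **Theorem 16 (1) (Riemann–Hurwitz)**: `K_G = φ^* K_{G′} + R_G` with
`R_G(x) = 2(m_φ(x) − 1) + v_φ(x)`. [cite: BakerNorine2009, Theorem 16 (1)] -/
theorem IsHarmonicMorphism.canonicalDivisor_eq_divPullback_add :
    canonicalDivisor G = divPullback G G' φ (canonicalDivisor G') +
      fun x => 2 * ((horizMult G G' φ x : ℤ) - 1) + vertMult G φ x := by
  funext x
  rw [Pi.add_apply, canonicalDivisor_apply, divPullback_apply, canonicalDivisor_apply,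
    hφ.degree_eq x]
  push_cast
  ring

omit hφ in
/-- `φ^*` is a homomorphism: `φ^*(D₁ − D₂) = φ^* D₁ − φ^* D₂`.
[cite: BakerNorine2009, §2.3 («the pullback homomorphism»)] -/
theorem divPullback_sub (D₁ D₂ : V' → ℤ) :
    divPullback G G' φ (D₁ - D₂) = divPullback G G' φ D₁ - divPullback G G' φ D₂ := by
  funext x
  simp only [divPullback_apply, Pi.sub_apply, mul_sub]

omit hφ in
/-- `φ^*` is a homomorphism: `φ^*(D₁ + D₂) = φ^* D₁ + φ^* D₂`.
[cite: BakerNorine2009, §2.3 («the pullback homomorphism»)] -/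
theorem divPullback_add (D₁ D₂ : V' → ℤ) :
    divPullback G G' φ (D₁ + D₂) = divPullback G G' φ D₁ + divPullback G G' φ D₂ := by
  funext x
  simp only [divPullback_apply, Pi.add_apply, mul_add]

/-- **Theorem 16 (2) (Riemann–Hurwitz)**:
`2g − 2 = deg(φ)(2g′ − 2) + Σ_x (2(m_φ(x) − 1) + v_φ(x))` (`G′` connected, the degree read at any
`y₀`). [cite: BakerNorine2009, Theorem 16 (2)] -/
theorem IsHarmonicMorphism.two_mul_genus_sub_two_eq (hG' : G'.Connected) (y₀ : V') :
    2 * genus G - 2 = (harmonicDegree G G' φ y₀ : ℤ) * (2 * genus G' - 2) +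
      ∑ x, (2 * ((horizMult G G' φ x : ℤ) - 1) + vertMult G φ x) := by
  rw [← sum_canonicalDivisor G, ← sum_canonicalDivisor G', hφ.canonicalDivisor_eq_divPullback_add,
    ← hφ.sum_divPullback hG' y₀]
  simp only [Pi.add_apply, Finset.sum_add_distrib]

/-! ### Pulling back harmonic functions and principal divisors (Proposition 12, Laplacian form) -/

variable [DecidableEq V]

/-- **Harmonic functions pull back** (Proposition 12 in Laplacian form):
`Δ(f ∘ φ)(x) = m_φ(x) · Δ′(f)(φ(x))`. [cite: BakerNorine2009, Proposition 12] -/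
theorem IsHarmonicMorphism.lapMatrix_mulVec_comp (f : V' → ℤ) (x : V) :
    (G.lapMatrix ℤ *ᵥ (f ∘ φ)) x = (horizMult G G' φ x : ℤ) * (G'.lapMatrix ℤ *ᵥ f) (φ x) := by
  rw [lapMatrix_mulVec_apply, lapMatrix_mulVec_apply]
  simp only [Function.comp_apply]
  rw [hφ.sum_neighborFinset_comp f x, hφ.degree_eq x]
  push_cast
  ring

/-- `φ^* Δ′(f) = Δ(f ∘ φ)`: the pull-back of a principal divisor is principal.
[cite: BakerNorine2009, Proposition 12 (with §2.3)] -/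
theorem IsHarmonicMorphism.divPullback_lapMatrix_mulVec (f : V' → ℤ) :
    divPullback G G' φ (G'.lapMatrix ℤ *ᵥ f) = G.lapMatrix ℤ *ᵥ (f ∘ φ) := by
  funext x
  rw [divPullback_apply, hφ.lapMatrix_mulVec_comp f x]

/-- **`φ^*` preserves linear equivalence** (so it induces a homomorphism `Jac(G′) → Jac(G)`):
`D₁ ∼ D₂ ⟹ φ^* D₁ ∼ φ^* D₂`. [cite: BakerNorine2009, §2.3 (with Proposition 12)] -/
theorem IsHarmonicMorphism.linEquiv_divPullback {D₁ D₂ : V' → ℤ} (h : LinEquiv G' D₁ D₂) :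
    LinEquiv G (divPullback G G' φ D₁) (divPullback G G' φ D₂) := by
  obtain ⟨f, hf⟩ := (linEquiv_iff_exists_eq_sub G' D₁ D₂).1 h
  rw [linEquiv_iff_exists_eq_sub]
  exact ⟨f ∘ φ, by rw [hf, divPullback_sub, hφ.divPullback_lapMatrix_mulVec]⟩

end Local

/-! ### Example: the identity -/

variable [DecidableEq V] in
/-- The identity is a harmonic morphism. [cite: BakerNorine2009, §2.1 (Remark 8: a category)] -/
theorem isHarmonicMorphism_id : IsHarmonicMorphism G G id where
  adj_or_eq := fun _ _ h => Or.inl h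
  conformal := fun x y₁ y₂ h₁ h₂ => by
    have key : ∀ y, G.Adj x y → #{u ∈ G.neighborFinset x | id u = y} = 1 := fun y hy => by
      rw [Finset.card_eq_one]
      refine ⟨y, ?_⟩
      ext u
      simp only [mem_filter, mem_neighborFinset, id_eq, mem_singleton]
      exact ⟨fun h => h.2, fun h => ⟨h ▸ hy, h⟩⟩
    rw [key y₁ h₁, key y₂ h₂]

end Literature.Combinatorics.SimpleGraph.BakerNorine
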